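import Summits.CriticalPhenomena.PercolationContinuityZ3.Theorems.PercNearOneGluingNoHeavyLowerTailAPLGeometricAll
import HarnessLib

/-!
# `NoHeavyLowerTail` (stmt-CriticalPhenomena-4575) — the Gladkov–Zimin Conjecture 6.3 with RATE `δ^{2/3}` on every finite weighted graph (from the admissible family of profile rows)

Support file (prover prim-ineq-gen-8 gen 39; `--supports stmt-CriticalPhenomena-4575`; memo
run/shared/lean/prim/prim-ineq-gen-8/FINDING-gen39-TE-CORES.md §5).  No definitions, no named facts, no sorries.

`μ = prodBernoulli w` on the pairs of a finite vertex type `V`; cells `u0 = μ(a|b|c)`, `uab = μ(ab|c)`, `uac = μ(ac|b)`, `ubc = μ(a|bc)`,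
`u3 = μ(a↔b, a↔c)` (sum `1`); isolation probabilities `U = u0`, `A = μ(a∤bc) = u0+ubc`, `B = μ(b∤ac) = u0+uac`, `C = μ(c∤ab) = u0+uab`.
Gen 38 (`…APLFamilyAll.lean`) proved the ADMISSIBLE FAMILY `U^{α+β} ≤ A·B^β·C^α` (`α, β ≥ 1`, `(α+β)² ≤ αβ(α+β+1)`) for every finite
weighted graph and derived APL-G and the Gladkov–Zimin Conjecture 6.3 with modulus `√δ + δ` (`…APLGeometricAll.lean`).  The envelope of
the family is strictly inside the APL-G cone at the sparse one-sided tip, and this file cashes that in: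
* `h_le_of_familyRow` — real lemma: `U^{α+β} ≤ A B^β C^α`, `0 < U ≤ B, C`, `α ≥ 0`, `β ≥ 1` ⟹ `U(1+U−C) − AB ≤ α(C−U) + (β−1)(B−U)`
  (logarithms, `t + 1 ≤ e^t`, `log x ≤ x − 1`);
* `gzh_le_family` — for every admissible `(α,β)`: **`u0·u3 − uac·ubc ≤ α·uab + (β−1)·uac`** (`h := u0u3 − uac·ubc = U(1+U−C) − AB`);
* `family_admissible_cubeRoot` — the pair `(2/t, 1+t²)`, `0 < t ≤ 1`, is admissible;
* **`gzh_le_three_cubeRoot`** — if `uab ≤ uac` then `u0·u3 − uac·ubc ≤ 3·(uab²·uac)^{1/3}` (`t = (uab/uac)^{1/3}`; the degenerate case `uab = 0`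
  is `aplG_all`);
* **`gz63_rate_all`** — for EVERY finite weighted graph: `μ(a↔b,a↔c) − μ(a↔c)·μ(b↔c) ≤ 4·μ(ab|c)^{2/3}`;
* **`gladkovZimin_conjecture_6_3_rate`** — the conjecture verbatim with `δ(ε) = min(1, (ε/4)^{3/2})` (gen 38: `min(1, ε²/4)`), i.e. the modulus of
  `P(abc) − P(ac)P(bc)` in `δ = P(ab|c)` improves from `√δ + δ` to `4·δ^{2/3}` (the tree envelope TE would give `O(δ·log(1/δ))`, attained on forests).
[this work]
-/

noncomputable section

namespace Summit.CriticalPhenomena.PercolationContinuityZ3.Theorems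

namespace APL

open MeasureTheory Set Literature.Probability.Percolation Literature.Probability.LatticeModels
open scoped Classical

variable {V : Type*} [Fintype V]

universe u

/-! ### The real lemma behind the rate -/

/-- From a family row `U^{α+β} ≤ A·B^β·C^α` with `0 < U ≤ B`, `U ≤ C`, `0 ≤ A`, `0 ≤ α`, `1 ≤ β`:
`U·(1+U−C) − A·B ≤ α·(C−U) + (β−1)·(B−U)`.  Proof: `log A ≥ −β·log(B/U) − α·log(C/U)`, so
`A·B ≥ U·exp(−(β−1)log(B/U) − α log(C/U)) ≥ U·(1 − (β−1)log(B/U) − α log(C/U)) ≥ U − (β−1)(B−U) − α(C−U)`. [this work] -/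
theorem h_le_of_familyRow (α β U A B C : ℝ) (hα : 0 ≤ α) (hβ : 1 ≤ β) (hU : 0 < U) (hUB : U ≤ B) (hUC : U ≤ C)
    (hA : 0 ≤ A) (hrow : U ^ (α + β) ≤ A * B ^ β * C ^ α) :
    U * (1 + U - C) - A * B ≤ α * (C - U) + (β - 1) * (B - U) := by
  have hB : 0 < B := lt_of_lt_of_le hU hUB
  have hC : 0 < C := lt_of_lt_of_le hU hUC
  have hApos : 0 < A := by
    rcases hA.lt_or_eq with h | h
    · exact h
    · exfalso
      rw [← h, zero_mul, zero_mul] at hrow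
      exact absurd hrow (not_le.mpr (Real.rpow_pos_of_pos hU _))
  set x := Real.log (C / U) with hxdef
  set y := Real.log (B / U) with hydef
  have hxle : U * x ≤ C - U := by
    have h1 : x ≤ C / U - 1 := Real.log_le_sub_one_of_pos (div_pos hC hU)
    have h2 : U * x ≤ U * (C / U - 1) := mul_le_mul_of_nonneg_left h1 hU.le
    have h3 : U * (C / U - 1) = C - U := by field_simp
    linarith
  have hyle : U * y ≤ B - U := by
    have h1 : y ≤ B / U - 1 := Real.log_le_sub_one_of_pos (div_pos hB hU)
    have h2 : U * y ≤ U * (B / U - 1) := mul_le_mul_of_nonneg_left h1 hU.le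
    have h3 : U * (B / U - 1) = B - U := by field_simp
    linarith
  -- logarithmic form of the row
  have hlog : (α + β) * Real.log U ≤ Real.log A + β * Real.log B + α * Real.log C := by
    have h1 := Real.log_le_log (Real.rpow_pos_of_pos hU _) hrow
    rw [Real.log_rpow hU, Real.log_mul (mul_pos hApos (Real.rpow_pos_of_pos hB _)).ne' (Real.rpow_pos_of_pos hC _).ne',
      Real.log_mul hApos.ne' (Real.rpow_pos_of_pos hB _).ne', Real.log_rpow hB, Real.log_rpow hC] at h1
    linarith
  have hlogB : Real.log B = Real.log U + y := by
    rw [hydef, Real.log_div hB.ne' hU.ne']; ring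
  have hlogC : Real.log C = Real.log U + x := by
    rw [hxdef, Real.log_div hC.ne' hU.ne']; ring
  -- `A·B ≥ U·(1 − ((β−1)·y + α·x))`
  have hAB : U * (1 - ((β - 1) * y + α * x)) ≤ A * B := by
    have e1 : A * B = Real.exp (Real.log A + Real.log B) := by
      rw [Real.exp_add, Real.exp_log hApos, Real.exp_log hB]
    have e2 : Real.log U + -((β - 1) * y + α * x) ≤ Real.log A + Real.log B := by
      rw [hlogB]
      rw [hlogB, hlogC] at hlog
      nlinarith
    have e3 : Real.exp (Real.log U + -((β - 1) * y + α * x)) ≤ A * B := by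
      rw [e1]; exact Real.exp_le_exp.mpr e2
    have e4 : Real.exp (Real.log U + -((β - 1) * y + α * x)) = U * Real.exp (-((β - 1) * y + α * x)) := by
      rw [Real.exp_add, Real.exp_log hU]
    have e5 : 1 - ((β - 1) * y + α * x) ≤ Real.exp (-((β - 1) * y + α * x)) := by
      have := Real.add_one_le_exp (-((β - 1) * y + α * x)); linarith
    calc U * (1 - ((β - 1) * y + α * x)) ≤ U * Real.exp (-((β - 1) * y + α * x)) :=
          mul_le_mul_of_nonneg_left e5 hU.le
      _ = Real.exp (Real.log U + -((β - 1) * y + α * x)) := e4.symm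
      _ ≤ A * B := e3
  have hβ1 : 0 ≤ β - 1 := by linarith
  have h1 : α * (U * x) ≤ α * (C - U) := mul_le_mul_of_nonneg_left hxle hα
  have h2 : (β - 1) * (U * y) ≤ (β - 1) * (B - U) := mul_le_mul_of_nonneg_left hyle hβ1
  have h3 : U * (U - C) ≤ 0 := mul_nonpos_of_nonneg_of_nonpos hU.le (by linarith)
  nlinarith [h1, h2, h3, hAB]

/-! ### `h = u0·u3 − uac·ubc` under the family -/

/-- **`h ≤ α·P(ab|c) + (β−1)·P(ac|b)` for every admissible `(α, β)` and every finite weighted graph**, where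
`h = μ(a|b|c)·μ(a↔b,a↔c) − μ(ac|b)·μ(a|bc)` (the Gladkov–Zimin quantity up to `+ μ(ab|c)·μ(a↔b,a↔c)`).
From `family_all` and `h_le_of_familyRow` (`h = U(1+U−C) − AB` by the cell identities). [this work] -/
theorem gzh_le_family (α β : ℝ) (hα : 1 ≤ α) (hβ : 1 ≤ β) (hadm : (α + β) ^ 2 ≤ α * β * (α + β + 1))
    (w : Sym2 V → unitInterval) (a b c : V) :
    (prodBernoulli w).real ((openConn a b)ᶜ ∩ (openConn a c)ᶜ ∩ (openConn b c)ᶜ : Set (BondConfig V))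
        * (prodBernoulli w).real (openConn a b ∩ openConn a c : Set (BondConfig V))
      - (prodBernoulli w).real (openConn a c ∩ (openConn a b)ᶜ : Set (BondConfig V))
        * (prodBernoulli w).real ((openConn a b)ᶜ ∩ (openConn a c)ᶜ ∩ openConn b c : Set (BondConfig V)) ≤
      α * (prodBernoulli w).real (openConn a b ∩ (openConn a c)ᶜ : Set (BondConfig V))
        + (β - 1) * (prodBernoulli w).real (openConn a c ∩ (openConn a b)ᶜ : Set (BondConfig V)) := by
  have hF := family_all α β hα hβ hadm w a b c
  rw [isoA_split, isoB_split, isoC_split] at hF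
  have hsum := prodBernoulli_cells_sum_eq_one w a b c
  set u0 := (prodBernoulli w).real ((openConn a b)ᶜ ∩ (openConn a c)ᶜ ∩ (openConn b c)ᶜ : Set (BondConfig V)) with hu0
  set uab := (prodBernoulli w).real (openConn a b ∩ (openConn a c)ᶜ : Set (BondConfig V)) with huab
  set uac := (prodBernoulli w).real (openConn a c ∩ (openConn a b)ᶜ : Set (BondConfig V)) with huac
  set ubc := (prodBernoulli w).real ((openConn a b)ᶜ ∩ (openConn a c)ᶜ ∩ openConn b c : Set (BondConfig V)) with hubc
  set u3 := (prodBernoulli w).real (openConn a b ∩ openConn a c : Set (BondConfig V)) with hu3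
  have h0 : 0 ≤ u0 := measureReal_nonneg
  have h1 : 0 ≤ uab := measureReal_nonneg
  have h2 : 0 ≤ uac := measureReal_nonneg
  have h3 : 0 ≤ ubc := measureReal_nonneg
  have hα0 : 0 ≤ α := by linarith
  have hβ1 : 0 ≤ β - 1 := by linarith
  rcases h0.lt_or_eq with hpos | hzero
  · have key := h_le_of_familyRow α β u0 (u0 + ubc) (u0 + uac) (u0 + uab) hα0 hβ (hpos) (by linarith) (by linarith)
      (by linarith) hF
    have e : u0 * u3 - uac * ubc = u0 * (1 + u0 - (u0 + uab)) - (u0 + ubc) * (u0 + uac) := by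
      have : u3 = 1 - u0 - uab - uac - ubc := by linarith
      rw [this]; ring
    rw [e]
    calc u0 * (1 + u0 - (u0 + uab)) - (u0 + ubc) * (u0 + uac)
        ≤ α * (u0 + uab - u0) + (β - 1) * (u0 + uac - u0) := key
      _ = α * uab + (β - 1) * uac := by ring
  · rw [← hzero]
    nlinarith [mul_nonneg h2 h3, mul_nonneg hα0 h1, mul_nonneg hβ1 h2]

/-- The pair `(α, β) = (2/t, 1 + t²)` is admissible for `0 < t ≤ 1`:
`(α+β)² ≤ αβ(α+β+1)` ⟺ `(2 + t + t³)² ≤ 2(1+t²)(2 + 2t + t³)` ⟺ `0 ≤ t²(3 + 2t − 2t² + 2t³ − t⁴)`. [this work] -/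
theorem family_admissible_cubeRoot (t : ℝ) (ht : 0 < t) (ht1 : t ≤ 1) :
    (2 / t + (1 + t ^ 2)) ^ 2 ≤ (2 / t) * (1 + t ^ 2) * (2 / t + (1 + t ^ 2) + 1) := by
  have key : (2 / t) * (1 + t ^ 2) * (2 / t + (1 + t ^ 2) + 1) - (2 / t + (1 + t ^ 2)) ^ 2
      = 3 + 2 * t - 2 * t ^ 2 + 2 * t ^ 3 - t ^ 4 := by
    field_simp
    ring
  have h2 : t ^ 2 ≤ 1 := pow_le_one₀ ht.le ht1
  have h4 : t ^ 4 ≤ 1 := pow_le_one₀ ht.le ht1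
  have h3 : 0 ≤ t ^ 3 := by positivity
  nlinarith [key, h2, h4, h3, ht.le]

/-- **`h ≤ 3·(uab²·uac)^{1/3}` when `uab ≤ uac`** (every finite weighted graph): with `t = (uab/uac)^{1/3} ∈ (0,1]` the admissible member
`(2/t, 1+t²)` of `gzh_le_family` gives `h ≤ (2/t)·uab + t²·uac = 3t²·uac = 3(uab²uac)^{1/3}`; the case `uab = 0` (`h ≤ 0`) is APL-G
(`aplG_all`: `TD − e = h − uab·ubc`, `(TD−e)² ≤ uab·uac = 0`). [this work] -/
theorem gzh_le_three_cubeRoot (w : Sym2 V → unitInterval) (a b c : V)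
    (hle : (prodBernoulli w).real (openConn a b ∩ (openConn a c)ᶜ : Set (BondConfig V)) ≤
      (prodBernoulli w).real (openConn a c ∩ (openConn a b)ᶜ : Set (BondConfig V))) :
    (prodBernoulli w).real ((openConn a b)ᶜ ∩ (openConn a c)ᶜ ∩ (openConn b c)ᶜ : Set (BondConfig V))
        * (prodBernoulli w).real (openConn a b ∩ openConn a c : Set (BondConfig V))
      - (prodBernoulli w).real (openConn a c ∩ (openConn a b)ᶜ : Set (BondConfig V))
        * (prodBernoulli w).real ((openConn a b)ᶜ ∩ (openConn a c)ᶜ ∩ openConn b c : Set (BondConfig V)) ≤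
      3 * ((prodBernoulli w).real (openConn a b ∩ (openConn a c)ᶜ : Set (BondConfig V)) ^ 2
            * (prodBernoulli w).real (openConn a c ∩ (openConn a b)ᶜ : Set (BondConfig V))) ^ ((3 : ℝ)⁻¹) := by
  have hsum := prodBernoulli_cells_sum_eq_one w a b c
  have hG := aplG_all w a b c
  set u0 := (prodBernoulli w).real ((openConn a b)ᶜ ∩ (openConn a c)ᶜ ∩ (openConn b c)ᶜ : Set (BondConfig V)) with hu0
  set uab := (prodBernoulli w).real (openConn a b ∩ (openConn a c)ᶜ : Set (BondConfig V)) with huab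
  set uac := (prodBernoulli w).real (openConn a c ∩ (openConn a b)ᶜ : Set (BondConfig V)) with huac
  set ubc := (prodBernoulli w).real ((openConn a b)ᶜ ∩ (openConn a c)ᶜ ∩ openConn b c : Set (BondConfig V)) with hubc
  set u3 := (prodBernoulli w).real (openConn a b ∩ openConn a c : Set (BondConfig V)) with hu3
  have h0 : 0 ≤ u0 := measureReal_nonneg
  have h1 : 0 ≤ uab := measureReal_nonneg
  have h2 : 0 ≤ uac := measureReal_nonneg
  have h3 : 0 ≤ ubc := measureReal_nonneg
  have h4 : 0 ≤ u3 := measureReal_nonneg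
  rcases h1.lt_or_eq with hpos | hzero
  · -- `t := (uab/uac)^{1/3}`, `uab = t³·uac`
    have huacpos : 0 < uac := lt_of_lt_of_le hpos hle
    set t := (uab / uac) ^ ((3 : ℝ)⁻¹) with htdef
    have htpos : 0 < t := Real.rpow_pos_of_pos (div_pos hpos huacpos) _
    have ht3 : t ^ 3 = uab / uac := by
      rw [htdef]; exact Real.rpow_inv_natCast_pow (div_pos hpos huacpos).le (by norm_num)
    have hq1 : uab / uac ≤ 1 := (div_le_one huacpos).mpr hle
    have ht1 : t ≤ 1 := Real.rpow_le_one (div_pos hpos huacpos).le hq1 (by norm_num)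
    have huabt : uab = t ^ 3 * uac := by
      rw [ht3]; field_simp
    -- the member `(2/t, 1+t²)`
    have hadm := family_admissible_cubeRoot t htpos ht1
    have hα : (1 : ℝ) ≤ 2 / t := by
      rw [le_div_iff₀ htpos]; linarith
    have hβ : (1 : ℝ) ≤ 1 + t ^ 2 := by nlinarith
    have key := gzh_le_family (2 / t) (1 + t ^ 2) hα hβ hadm w a b c
    -- `(2/t)·uab + t²·uac = 3·t²·uac`
    have e1 : 2 / t * uab + (1 + t ^ 2 - 1) * uac = 3 * (t ^ 2 * uac) := by
      rw [huabt]; field_simp; ring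
    -- `t²·uac = (uab²·uac)^{1/3}`
    have e2 : t ^ 2 * uac = (uab ^ 2 * uac) ^ ((3 : ℝ)⁻¹) := by
      have hcube : (t ^ 2 * uac) ^ 3 = uab ^ 2 * uac := by rw [huabt]; ring
      have hnn : 0 ≤ t ^ 2 * uac := by positivity
      have e3 : ((t ^ 2 * uac) ^ 3) ^ ((3 : ℝ)⁻¹) = t ^ 2 * uac := Real.pow_rpow_inv_natCast hnn (by norm_num)
      rw [← hcube]
      exact e3.symm
    calc u0 * u3 - uac * ubc ≤ 2 / t * uab + (1 + t ^ 2 - 1) * uac := key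
      _ = 3 * (t ^ 2 * uac) := e1
      _ = 3 * (uab ^ 2 * uac) ^ ((3 : ℝ)⁻¹) := by rw [e2]
  · -- `uab = 0`: APL-G forces `TD = e`, i.e. `h = uab·ubc = 0`
    have hz : uab = 0 := hzero.symm
    rw [hz]
    simp only [ne_eq, OfNat.ofNat_ne_zero, not_false_eq_true, zero_pow, zero_mul, Real.zero_rpow
      (inv_ne_zero (by norm_num : (3 : ℝ) ≠ 0)), mul_zero]
    -- `hG : ((uab+uac+u3)(u0+uab+uac) − (uab+uac))² ≤ uab·uac`
    rw [hz] at hG hsum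
    have hsq : ((0 + uac + u3) * (u0 + 0 + uac) - (0 + uac)) ^ 2 ≤ 0 := by simpa using hG
    have hzero' : (0 + uac + u3) * (u0 + 0 + uac) - (0 + uac) = 0 := by
      nlinarith [sq_nonneg ((0 + uac + u3) * (u0 + 0 + uac) - (0 + uac))]
    -- `h = (TD − e) + uab·ubc = TD − e` when the cells sum to one
    have : u0 * u3 - uac * ubc = (0 + uac + u3) * (u0 + 0 + uac) - (0 + uac) := by
      have hubc' : ubc = 1 - u0 - uac - u3 := by linarith
      rw [hubc']; ring
    rw [this, hzero']

/-! ### The Gladkov–Zimin quantity -/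

/-- **Gladkov–Zimin 6.3 with rate `2/3`, every finite weighted graph**:
`μ(a↔b, a↔c) − μ(a↔c)·μ(b↔c) ≤ 4·μ(ab|c)^{2/3}`.  Proof: `P(abc) − P(ac)P(bc) = h + uab·u3`; if `uab ≤ uac`,
`h ≤ 3(uab²uac)^{1/3} ≤ 3·uab^{2/3}` (`gzh_le_three_cubeRoot`) and `uab·u3 ≤ uab ≤ uab^{2/3}`; if `uab > uac`, APL-G gives
`P(abc) − P(ac)P(bc) ≤ sqrt(uab·uac) + uab ≤ 2·uab ≤ 2·uab^{2/3}` (`gz63_all`). [this work] -/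
theorem gz63_rate_all (w : Sym2 V → unitInterval) (a b c : V) :
    (prodBernoulli w).real (openConn a b ∩ openConn a c : Set (BondConfig V))
      - (prodBernoulli w).real (openConn a c : Set (BondConfig V)) * (prodBernoulli w).real (openConn b c : Set (BondConfig V)) ≤
      4 * (prodBernoulli w).real (openConn a b ∩ (openConn a c)ᶜ : Set (BondConfig V)) ^ ((2 : ℝ) / 3) := by
  have hsum := prodBernoulli_cells_sum_eq_one w a b c
  have hgz := gz63_all w a b c
  rw [← real_conn_ac_eq_cells, ← real_conn_bc_eq_cells] at hgz
  rw [real_conn_ac_eq_cells, real_conn_bc_eq_cells]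
  rw [real_conn_ac_eq_cells, real_conn_bc_eq_cells] at hgz
  set u0 := (prodBernoulli w).real ((openConn a b)ᶜ ∩ (openConn a c)ᶜ ∩ (openConn b c)ᶜ : Set (BondConfig V)) with hu0
  set uab := (prodBernoulli w).real (openConn a b ∩ (openConn a c)ᶜ : Set (BondConfig V)) with huab
  set uac := (prodBernoulli w).real (openConn a c ∩ (openConn a b)ᶜ : Set (BondConfig V)) with huac
  set ubc := (prodBernoulli w).real ((openConn a b)ᶜ ∩ (openConn a c)ᶜ ∩ openConn b c : Set (BondConfig V)) with hubc
  set u3 := (prodBernoulli w).real (openConn a b ∩ openConn a c : Set (BondConfig V)) with hu3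
  have h0 : 0 ≤ u0 := measureReal_nonneg
  have h1 : 0 ≤ uab := measureReal_nonneg
  have h2 : 0 ≤ uac := measureReal_nonneg
  have h3 : 0 ≤ ubc := measureReal_nonneg
  have h4 : 0 ≤ u3 := measureReal_nonneg
  have huab1 : uab ≤ 1 := measureReal_le_one
  have huac1 : uac ≤ 1 := measureReal_le_one
  -- `uab ≤ uab^{2/3}` on `[0,1]`
  have hpow : uab ≤ uab ^ ((2 : ℝ) / 3) := by
    rcases h1.lt_or_eq with hpos | hzero
    · calc uab = uab ^ (1 : ℝ) := (Real.rpow_one uab).symm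
        _ ≤ uab ^ ((2 : ℝ) / 3) := Real.rpow_le_rpow_of_exponent_ge hpos huab1 (by norm_num)
    · rw [← hzero, Real.zero_rpow (by norm_num)]
  -- the identity `P(abc) − P(ac)P(bc) = h + uab·u3`
  have hid : u3 - (uac + u3) * (ubc + u3) = (u0 * u3 - uac * ubc) + uab * u3 := by
    have : u0 = 1 - uab - uac - ubc - u3 := by linarith
    rw [this]; ring
  rw [hid]
  rcases le_or_gt uab uac with hle | hgt
  · have hh := gzh_le_three_cubeRoot w a b c hle
    -- `(uab²·uac)^{1/3} ≤ (uab²)^{1/3} = uab^{2/3}`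
    have hmono : (uab ^ 2 * uac) ^ ((3 : ℝ)⁻¹) ≤ uab ^ ((2 : ℝ) / 3) := by
      have hle1 : uab ^ 2 * uac ≤ uab ^ 2 := by nlinarith [sq_nonneg uab]
      calc (uab ^ 2 * uac) ^ ((3 : ℝ)⁻¹) ≤ (uab ^ 2) ^ ((3 : ℝ)⁻¹) :=
            Real.rpow_le_rpow (by positivity) hle1 (by norm_num)
        _ = uab ^ ((2 : ℝ) / 3) := by
            rw [show ((2 : ℝ) / 3) = 2 * (3 : ℝ)⁻¹ by norm_num, Real.rpow_mul h1, Real.rpow_two]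
    have hu3le : uab * u3 ≤ uab := by nlinarith
    calc (u0 * u3 - uac * ubc) + uab * u3 ≤ 3 * (uab ^ 2 * uac) ^ ((3 : ℝ)⁻¹) + uab := by linarith
      _ ≤ 3 * uab ^ ((2 : ℝ) / 3) + uab ^ ((2 : ℝ) / 3) := by linarith
      _ = 4 * uab ^ ((2 : ℝ) / 3) := by ring
  · -- `uab > uac`: APL-G, `sqrt(uab·uac) ≤ uab`
    have hs : Real.sqrt (uab * uac) ≤ uab := by
      calc Real.sqrt (uab * uac) ≤ Real.sqrt (uab * uab) := Real.sqrt_le_sqrt (by nlinarith)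
        _ = uab := Real.sqrt_mul_self h1
    have hbc : uab * (ubc + u3) ≤ uab := by nlinarith
    rw [← hid]
    calc u3 - (uac + u3) * (ubc + u3) ≤ Real.sqrt (uab * uac) + uab * (ubc + u3) := hgz
      _ ≤ uab + uab := by linarith
      _ ≤ 4 * uab ^ ((2 : ℝ) / 3) := by linarith

/-- **The Gladkov–Zimin Conjecture 6.3, verbatim, with `δ(ε) = min(1, (ε/4)^{3/2})`** (Gladkov–Zimin, ECP 31 (2026), arXiv:2404.08873,
Conj. 6.3 = Gladkov arXiv:2408.08457 Conj. 10.1): for every `ε > 0` and this `δ`, for EVERY finite vertex type, weights and `a, b, c`: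
`P(ab|c) < δ ⟹ P(abc) − P(ac)·P(bc) < ε`.  Improves gen 38's `δ = min(1, ε²/4)` (`gladkovZimin_conjecture_6_3`). [this work] -/
theorem gladkovZimin_conjecture_6_3_rate (ε : ℝ) (hε : 0 < ε) :
    ∃ δ : ℝ, 0 < δ ∧ δ = min 1 ((ε / 4) ^ ((3 : ℝ) / 2)) ∧ ∀ (W : Type u) [Fintype W] (w : Sym2 W → unitInterval) (a b c : W),
      (prodBernoulli w).real (openConn a b ∩ (openConn a c)ᶜ : Set (BondConfig W)) < δ →
        (prodBernoulli w).real (openConn a b ∩ openConn a c : Set (BondConfig W))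
          - (prodBernoulli w).real (openConn a c : Set (BondConfig W)) * (prodBernoulli w).real (openConn b c : Set (BondConfig W)) < ε := by
  have hε4 : 0 < ε / 4 := by positivity
  refine ⟨min 1 ((ε / 4) ^ ((3 : ℝ) / 2)), lt_min zero_lt_one (Real.rpow_pos_of_pos hε4 _), rfl, ?_⟩
  intro W _ w a b c hab
  have h := gz63_rate_all w a b c
  set uab := (prodBernoulli w).real (openConn a b ∩ (openConn a c)ᶜ : Set (BondConfig W)) with huabdef
  have huab : 0 ≤ uab := measureReal_nonneg
  have hδ2 : uab < (ε / 4) ^ ((3 : ℝ) / 2) := lt_of_lt_of_le hab (min_le_right _ _)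
  -- `uab^{2/3} < ((ε/4)^{3/2})^{2/3} = ε/4`
  have h1 : uab ^ ((2 : ℝ) / 3) < ε / 4 := by
    calc uab ^ ((2 : ℝ) / 3) < ((ε / 4) ^ ((3 : ℝ) / 2)) ^ ((2 : ℝ) / 3) := Real.rpow_lt_rpow huab hδ2 (by norm_num)
      _ = ε / 4 := by
        rw [← Real.rpow_mul hε4.le, show ((3 : ℝ) / 2) * (2 / 3) = 1 by norm_num, Real.rpow_one]
  linarith

end APL

end Summit.CriticalPhenomena.PercolationContinuityZ3.Theorems

end
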